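import Mathlib
import Summits.Ventures.PercRepro2.Defs
import Summits.Ventures.PercRepro2.Independence
import Summits.Ventures.PercRepro2.Harris
import Summits.Ventures.PercRepro2.Graph
import Summits.Ventures.PercRepro2.Exploration
import Summits.Ventures.PercRepro2.Induced
import Summits.Ventures.PercRepro2.R2PrimeThreeReduction
import Summits.Ventures.PercRepro2.YBridge
import Summits.Ventures.PercRepro2.HCov
import Summits.Ventures.PercRepro2.HubModel
import Summits.Ventures.PercRepro2.HubLaw
import Summits.Ventures.PercRepro2.HubRootLaw
import Summits.Ventures.PercRepro2.HubConn
import Summits.Ventures.PercRepro2.HubBernstein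
import Summits.Ventures.PercRepro2.HubGc
import Summits.Ventures.PercRepro2.HubKron
import Summits.Ventures.PercRepro2.HubCert

/-!
# The inner law: consistency, total mass, and the Harris slacks
(blind cell PercRepro2, typer-1 g8; MINE2-HUB.md §2 (c), HUB-LEAN-SCOPE.md (S5))

The inner pattern `Π = innerPat` is monotone in the configuration (`innerPat_mono`), so the event
`{U(Π)}` of a monotone pattern predicate is an up-set (`isUpperSet_patEvent`) and the Harris–FKG
inequality of `Harris.lean` applies to two of the eight up-sets `upPat`: every **Harris slack**
`Hslack u v m = P(U_u ∩ U_v) · S − P(U_u) · P(U_v)` of the atom masses `m_a = P(Π = atomPat a)`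
is nonnegative (`Hslack_nonneg`).  The pattern is always consistent (`innerPat_consistent`,
transitivity of connection), so the inconsistent patterns carry no mass
(`prob_innerPat_eq_zero`) and the atom masses sum to one (`sum_atomMass`).
-/

namespace Summit.Ventures.PercRepro2.Hub

variable {V : Type*} {E : Type*}

section Monotone

variable {ends : E → Sym2 V} {μ : Mark → V}

/-- The inner configuration is monotone. -/
lemma innerConfig_mono {ω ω' : Config E} (h : ω ≤ ω') :
    innerConfig ends μ ω ≤ innerConfig ends μ ω' := by
  intro e
  by_cases he : e ∈ touches ends {μ .a₁, μ .a₂}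
  · rw [innerConfig, innerConfig, delConfig_apply_of_mem he, delConfig_apply_of_mem he]
  · rw [innerConfig, innerConfig, delConfig_apply_of_notMem he, delConfig_apply_of_notMem he]
    exact h e

open Classical in
/-- A bit of the inner pattern is a connection in `G′`. -/
lemma innerPat_eq_true_iff (ω : Config E) (i : Fin 3) :
    innerPat ends μ ω i = true ↔
      Conn ends (innerConfig ends μ ω) (μ (ipair i).1) (μ (ipair i).2) := by
  unfold innerPat
  exact decide_eq_true_iff

/-- **The inner pattern is monotone** in the configuration. -/
lemma innerPat_mono {ω ω' : Config E} (h : ω ≤ ω') (i : Fin 3)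
    (hi : innerPat ends μ ω i = true) : innerPat ends μ ω' i = true := by
  rw [innerPat_eq_true_iff] at hi ⊢
  exact conn_mono (innerConfig_mono h) hi

/-- The event of a monotone pattern predicate is an up-set. -/
lemma isUpperSet_patEvent (U : (Fin 3 → Bool) → Bool)
    (hU : ∀ π π', (∀ i, π i = true → π' i = true) → U π = true → U π' = true) :
    IsUpperSet {ω : Config E | U (innerPat ends μ ω) = true} := by
  intro ω ω' h hω
  exact hU _ _ (fun i hi => innerPat_mono h i hi) hω

/-- **The inner pattern is consistent**: connection is transitive. -/
lemma innerPat_consistent (ω : Config E) : consistent (innerPat ends μ ω) = true := by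
  have t1 : Conn ends (innerConfig ends μ ω) (μ .o) (μ .a₃) →
      Conn ends (innerConfig ends μ ω) (μ .a₃) (μ .b) →
      Conn ends (innerConfig ends μ ω) (μ .o) (μ .b) := fun h1 h2 => conn_trans h1 h2
  have t2 : Conn ends (innerConfig ends μ ω) (μ .a₃) (μ .b) →
      Conn ends (innerConfig ends μ ω) (μ .o) (μ .b) →
      Conn ends (innerConfig ends μ ω) (μ .o) (μ .a₃) := fun h1 h2 => conn_trans h2 (conn_symm h1)
  have t3 : Conn ends (innerConfig ends μ ω) (μ .o) (μ .a₃) →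
      Conn ends (innerConfig ends μ ω) (μ .o) (μ .b) →
      Conn ends (innerConfig ends μ ω) (μ .a₃) (μ .b) := fun h1 h2 => conn_trans (conn_symm h1) h2
  have e0 := innerPat_eq_true_iff (ends := ends) (μ := μ) ω 0
  have e1 := innerPat_eq_true_iff (ends := ends) (μ := μ) ω 1
  have e2 := innerPat_eq_true_iff (ends := ends) (μ := μ) ω 2
  simp only [ipair] at e0 e1 e2
  have f0 : innerPat ends μ ω 0 = false ↔ ¬ Conn ends (innerConfig ends μ ω) (μ .o) (μ .a₃) := by
    rw [← e0, Bool.eq_false_iff]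
  have f1 : innerPat ends μ ω 1 = false ↔ ¬ Conn ends (innerConfig ends μ ω) (μ .a₃) (μ .b) := by
    rw [← e1, Bool.eq_false_iff]
  have f2 : innerPat ends μ ω 2 = false ↔ ¬ Conn ends (innerConfig ends μ ω) (μ .o) (μ .b) := by
    rw [← e2, Bool.eq_false_iff]
  simp only [consistent, Bool.and_eq_true, Bool.or_eq_true, Bool.not_eq_true', Bool.and_eq_false_iff,
    e0, e1, e2, f0, f1, f2]
  tauto

end Monotone

section Masses

variable [Fintype E] [DecidableEq E] {R : Type*} [CommRing R] {ends : E → Sym2 V} {μ : Mark → V}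

/-- Inconsistent patterns carry no mass. -/
lemma prob_innerPat_eq_zero (p : E → R) (π : Fin 3 → Bool) (hπ : consistent π = false) :
    prob p {ω | innerPat ends μ ω = π} = 0 := by
  convert prob_empty p
  ext ω
  simp only [Set.mem_setOf_eq, Set.mem_empty_iff_false, iff_false]
  intro h
  have := innerPat_consistent (ends := ends) (μ := μ) ω
  rw [h, hπ] at this
  exact Bool.false_ne_true this

/-- The probability of a pattern event as a sum over the patterns. -/
lemma prob_patEvent (p : E → R) (U : (Fin 3 → Bool) → Bool) :
    prob p {ω | U (innerPat ends μ ω) = true} =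
      ∑ π, if U π then prob p {ω | innerPat ends μ ω = π} else 0 := by
  classical
  rw [prob_eq_sum_fiber p (innerPat ends μ)]
  refine Finset.sum_congr rfl fun π _ => ?_
  by_cases hU : U π = true
  · rw [if_pos hU]
    congr 1
    ext ω
    simp only [Set.mem_inter_iff, Set.mem_setOf_eq]
    constructor
    · exact fun h => h.2
    · intro h
      exact ⟨by rw [h]; exact hU, h⟩
  · rw [if_neg hU]
    convert prob_empty p
    ext ω
    simp only [Set.mem_inter_iff, Set.mem_setOf_eq, Set.mem_empty_iff_false, iff_false, not_and]
    intro h1 h2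
    rw [h2] at h1
    exact hU h1

/-- The probability of a pattern event as a sum over the atoms. -/
lemma prob_patEvent_atoms (p : E → R) (U : (Fin 3 → Bool) → Bool) :
    prob p {ω | U (innerPat ends μ ω) = true} =
      ∑ a, if U (atomPat a) then prob p {ω | innerPat ends μ ω = atomPat a} else 0 := by
  rw [prob_patEvent]
  exact sum_atom _ fun π hπ => by simp [prob_innerPat_eq_zero p π hπ]

/-- **The atom masses sum to one.** -/
theorem sum_atomMass (p : E → R) :
    ∑ a, prob p {ω | innerPat ends μ ω = atomPat a} = 1 := by
  have h := prob_patEvent_atoms (ends := ends) (μ := μ) p (fun _ => true)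
  simp only [if_true] at h
  rw [← h]
  convert prob_univ p
  ext ω
  simp

end Masses

section Harris

variable [Fintype E] [DecidableEq E] {R : Type*} [CommRing R] [LinearOrder R] [IsStrictOrderedRing R]
  {ends : E → Sym2 V} {μ : Mark → V}

/-- **The Harris slacks of the inner law are nonnegative** (Harris–FKG on `G′`). -/
theorem Hslack_nonneg (p : E → R) (hp : IsProbVec p) (u v : Fin 8) :
    0 ≤ Hslack u v fun a => prob p {ω | innerPat ends μ ω = atomPat a} := by
  have hU : ∀ u, IsUpperSet {ω : Config E | upPat u (innerPat ends μ ω) = true} :=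
    fun u => isUpperSet_patEvent (upPat u) (upPat_mono u)
  have hH := prob_mul_prob_le_prob_inter hp (hU u) (hU v)
  have hinter : {ω : Config E | upPat u (innerPat ends μ ω) = true} ∩
      {ω | upPat v (innerPat ends μ ω) = true} =
      {ω | (upPat u (innerPat ends μ ω) && upPat v (innerPat ends μ ω)) = true} := by
    ext ω
    simp [Bool.and_eq_true]
  have h3 : prob p {ω | (upPat u (innerPat ends μ ω) && upPat v (innerPat ends μ ω)) = true} =
      ∑ a, if (upPat u (atomPat a) && upPat v (atomPat a)) then
        prob p {ω | innerPat ends μ ω = atomPat a} else 0 :=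
    prob_patEvent_atoms p fun π => upPat u π && upPat v π
  rw [hinter, prob_patEvent_atoms p (upPat u), prob_patEvent_atoms p (upPat v), h3] at hH
  unfold Hslack
  rw [sum_atomMass, mul_one]
  have e1 : ∀ w : Fin 8, (∑ a, (iu w a : R) * prob p {ω | innerPat ends μ ω = atomPat a}) =
      ∑ a, if upPat w (atomPat a) then prob p {ω | innerPat ends μ ω = atomPat a} else 0 := by
    intro w
    refine Finset.sum_congr rfl fun a _ => ?_
    unfold iu upA
    split_ifs <;> simp
  have e2 : (∑ a, (iu u a : R) * iu v a * prob p {ω | innerPat ends μ ω = atomPat a}) =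
      ∑ a, if (upPat u (atomPat a) && upPat v (atomPat a)) then
        prob p {ω | innerPat ends μ ω = atomPat a} else 0 := by
    refine Finset.sum_congr rfl fun a _ => ?_
    unfold iu upA
    split_ifs <;> simp_all
  rw [e1, e1, e2]
  linarith

end Harris

end Summit.Ventures.PercRepro2.Hub
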